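import Literature.NumberTheory.LFunctions.DirichletLTruncationPacked
import HarnessLib

/-!
# Packed truncation certificates — soundness of the `U`-walk in the frame

The frame certificate `LTruncationPacked.certTframe` runs the order-2 packed walk `walkD` (binary splitting) on the weighted digits
of `x(n) = v(n) + B⁻[n = 1] − B⁻[n = 2]`: its passing certifies `U(N) + B⁻ ≥ 0` for `1 ≤ N < q` and returns the final sums
`[S(q−1), U(q−1) + B⁻]`, i.e. the hypotheses `U(N) ≥ −B⁻` (`N < q`) and (with `v(q) = 0`) `U(q) = u₂ − B⁻ + s₁` of
`LTruncationCert.lfunction_ne_zero_of_truncation_drift`. [cite: Chua2005RealZeros, §2.2 ALGO 1]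
-/

namespace Literature.NumberTheory.LFunctions

namespace LTruncationPacked

open Finset FeketePolyaKernel LTruncationCert Literature.Analysis.Convolution

section UWalk

variable {v : ℕ → ℤ} (Bm : ℕ)

/-- The shifted sequence `x(n) = v(n) + B⁻[n=1] − B⁻[n=2]`. [cite: Chua2005RealZeros, §2.2 ALGO 1] -/
def xSh (v : ℕ → ℤ) (Bm : ℕ) (n : ℕ) : ℤ :=
  v n + (if n = 1 then (Bm : ℤ) else 0) - (if n = 2 then (Bm : ℤ) else 0)

/-- Its plus digits. [cite: Chua2005RealZeros, §2.2 ALGO 1] -/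
def dpSh (v : ℕ → ℤ) (Bm : ℕ) (n : ℕ) : ℕ := ind (v n = 1) + (if n = 1 then Bm else 0)

/-- Its minus digits. [cite: Chua2005RealZeros, §2.2 ALGO 1] -/
def dmSh (v : ℕ → ℤ) (Bm : ℕ) (n : ℕ) : ℕ := ind (v n = -1) + (if n = 2 then Bm else 0)

/-- First sums of the shifted sequence: `S_x(n) = S_v(n) + B⁻[n ≥ 1] − B⁻[n ≥ 2]`. [folklore] -/
private theorem itS_one_xSh : ∀ n : ℕ,
    itS (xSh v Bm) 1 n = Sv v n + (if 1 ≤ n then (Bm : ℤ) else 0) - (if 2 ≤ n then (Bm : ℤ) else 0) := by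
  intro n
  induction n with
  | zero => simp [itS_succ_zero, Sv]
  | succ n ih =>
    rw [itS_succ_succ, ih, itS, Sv, xSh]
    rcases Nat.lt_or_ge n 2 with hn | hn
    · interval_cases n
      · simp; ring
      · simp
    · have h1 : 1 ≤ n := by omega
      have h3 : n + 1 ≠ 1 := by omega
      have h4 : n + 1 ≠ 2 := by omega
      simp only [h1, hn, show 1 ≤ n + 1 by omega, show 2 ≤ n + 1 by omega, if_true, h3, h4, if_false]
      ring

/-- Second sums of the shifted sequence: `U_x(n) = U_v(n) + B⁻[n ≥ 1]`. [folklore] -/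
private theorem itS_two_xSh : ∀ n : ℕ,
    itS (xSh v Bm) 2 n = Uv v n + (if 1 ≤ n then (Bm : ℤ) else 0) := by
  intro n
  induction n with
  | zero => simp [itS_succ_zero, Uv]
  | succ n ih =>
    rw [itS_succ_succ, ih, itS_one_xSh Bm, Uv]
    rcases Nat.lt_or_ge n 1 with hn | hn
    · interval_cases n; simp; ring
    · simp only [hn, show 1 ≤ n + 1 by omega, show 2 ≤ n + 1 by omega, if_true]
      ring

/-- A packed vector supported on one digit. [folklore] -/
private theorem kpack_single (b q c k : ℕ) (hk : k < q) :
    kpack b q (fun n => if n = k then c else 0) = c <<< (b * k) := by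
  rw [kpack, Finset.sum_eq_single k, if_pos rfl, Nat.shiftLeft_eq]
  · intro j _ hj; rw [if_neg hj, zero_mul]
  · intro h; exact absurd (Finset.mem_range.2 hk) h

/-- **The `U`-walk.** From `walkD b (B⁻+1) e q (P + B⁻·2^b) (M + B⁻·2^{2b}) [0,0] = some [s₁, u₂]` on the sign tables `(P, M)` of `v`
(`v(0) = 0`, values in `{0, ±1}`, `q ≥ 3`, `B⁻ + 1 < 2^b`): `U_v(N) ≥ −B⁻` for `N < q` and `u₂ − B⁻ + s₁ = U_v(q−1) + S_v(q−1)`.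
[cite: Chua2005RealZeros, §2.2 ALGO 1] -/
theorem uwalk_spec {b e q : ℕ} (hv : ∀ n, v n = 0 ∨ v n = 1 ∨ v n = -1) (hv0 : v 0 = 0) (hb : 2 ≤ b)
    (hBm : Bm + 1 < 2 ^ b) (hq : 3 ≤ q) {PM : ℕ × ℕ} (htab : IsSignTab b q v PM) {s1 u2 : ℤ}
    (h : walkD b (Bm + 1) e q (PM.1 + (Bm <<< b)) (PM.2 + (Bm <<< (2 * b))) [0, 0] = some [s1, u2]) :
    (∀ N, N < q → -(Bm : ℤ) ≤ Uv v N) ∧ u2 - Bm + s1 = Uv v (q - 1) + Sv v (q - 1) := by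
  -- the digits of the shifted sequence
  have hdp : ∀ n, dpSh v Bm n ≤ Bm + 1 := fun n => by
    rw [dpSh, ind]; split_ifs <;> omega
  have hdm : ∀ n, dmSh v Bm n ≤ Bm + 1 := fun n => by
    rw [dmSh, ind]; split_ifs <;> omega
  have hx : ∀ n, (dpSh v Bm n : ℤ) - dmSh v Bm n = xSh v Bm n := fun n => by
    rw [dpSh, dmSh, xSh, ind, ind]
    rcases hv n with h0 | h1 | h2
    · simp [h0]
    · simp [h1]
    · simp [h2]; ring
  have hx0 : xSh v Bm 0 = 0 := by simp [xSh, hv0]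
  -- the tables are the packed digit vectors
  have hP : PM.1 + (Bm <<< b) = kpack b q fun i => dpSh v Bm (0 + i) := by
    simp only [zero_add]
    rw [htab.1, show (fun i => dpSh v Bm i) = fun i => ind (v i = 1) + (if i = 1 then Bm else 0) from rfl,
      ← kpack_add_kpack, kpack_single b q Bm 1 (by omega), mul_one]
  have hM : PM.2 + (Bm <<< (2 * b)) = kpack b q fun i => dmSh v Bm (0 + i) := by
    simp only [zero_add]
    rw [htab.2, show (fun i => dmSh v Bm i) = fun i => ind (v i = -1) + (if i = 2 then Bm else 0) from rfl,
      ← kpack_add_kpack, kpack_single b q Bm 2 (by omega), mul_comm]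
  have hst : ([0, 0] : List ℤ) = stList (fun k => itS (xSh v Bm) k (0 - 1)) 0 2 := by
    simp [stList, itS_zero hx0]
  rw [hP, hM, hst] at h
  obtain ⟨hfin, hpos⟩ := walkD_spec (K := 2) hb hBm hx0 hdp hdm hx e q 0 _ h
  have h1 := itS_one_xSh (v := v) Bm
  have h2 := itS_two_xSh (v := v) Bm
  constructor
  · intro N hN
    rcases Nat.eq_zero_or_pos N with rfl | hN0
    · simp [Uv]
    · have := hpos N (Nat.zero_le _) (by simpa using hN)
      rw [h2 N, if_pos (show 1 ≤ N from hN0)] at this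
      linarith
  · have hq1 : 0 + q - 1 = q - 1 := by omega
    rw [hq1] at hfin
    simp only [stList, List.cons.injEq] at hfin
    obtain ⟨hs1, hu2, -⟩ := hfin
    rw [hs1, hu2, h1, h2, if_pos (show 1 ≤ q - 1 by omega), if_pos (show 2 ≤ q - 1 by omega)]
    ring

end UWalk

end LTruncationPacked

end Literature.NumberTheory.LFunctions
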